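import Literature.NumberTheory.Sieve.RoughNumbersClassesBuchstabIdentity
import Literature.NumberTheory.Sieve.RoughNumbersClassesSqrtRange
import Literature.NumberTheory.Sieve.RoughNumbersBuchstab
import HarnessLib

/-!
# Rough numbers are equidistributed among the reduced residue classes

Topic `Literature/NumberTheory/Sieve`. Everything here is PROVED (no definitions, no named facts).
Write `Φ(x, y; q, c) = #{1 ≤ m ≤ x : m ≡ c (mod q), p ∣ m ⇒ p ≥ y}`
`= #((roughIcc ⌈y⌉₊ ⌊x⌋₊).filter (· ≡ c [MOD q]))` and `Φ(x, y) = #roughIcc ⌈y⌉₊ ⌊x⌋₊`.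
For a FIXED modulus `q ≥ 1` (sub-namespace `RoughAP`):

* `exists_forall_abs_card_filter_sub_le` — for every `n ≥ 2` and `ε > 0` there is `x₀` such that
  `|Φ(x, y; q, c) − Φ(x, y; q, c')| ≤ ε x/log y` for all `x ≥ x₀`, `2 ≤ y ≤ x`, `log x ≤ n log y`,
  `y > q` and all reduced classes `c, c'`;
* `exists_forall_abs_card_filter_sub_div_totient_le` — hence
  `|Φ(x, y; q, c) − Φ(x, y)/φ(q)| ≤ ε x/log y` in the same range (rough numbers with `y > q` are
  prime to `q`, `card_roughIcc_eq_sum_card_filter`);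
* `exists_forall_abs_card_filter_sub_buchstab_le` — with the tree's PROVED integer law
  `Φ(x, y) = ω(u) x/log y + O(x/log² y)` (`exists_abs_card_roughIcc_sub_buchstab_le`, Lichtman's
  Lemma 6.1): `|Φ(x, y; q, c) − ω(log x/log y) x/(φ(q) log y)| ≤ ε x/log y` for `x ≥ x₀(q, U, ε)`,
  `2 ≤ y`, `q < y`, `y² ≤ x ≤ y^U`, `(c, q) = 1` — **Buchstab's asymptotic for the rough numbers of
  a reduced residue class**, `Φ(x, y; q, c) ∼ ω(u) x/(φ(q) log y)`.

This is the arithmetic-progression form of Buchstab's `Φ(x, y) ∼ ω(u) x/log y` (Tenenbaum,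
Ch. III.6), in qualitative form and for bounded `u`.  Proof: induction on `n` with pure upper bounds
(no main terms): the base `n = 2` is `abs_card_filter_sub_le_base` (`RoughNumbersClassesSqrtRange.lean`:
primes are equidistributed in the reduced classes, PROVED prime number theorem in arithmetic
progressions), the step `n → n + 1` (`abs_card_filter_sub_le_step`) takes `z = x^{1/n}` for
`n log y < log x ≤ (n + 1) log y` and applies `abs_card_filter_sub_le_step_of`
(`RoughNumbersClassesBuchstabIdentity.lean`: Buchstab's identity for the class counts and
`∑_{y ≤ p < z} 1/p = O(1)`); the inequalities between the parameters are those of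
`RoughNumbersBuchstabStep.lean`, copied.

## References

* G. Tenenbaum, *Introduction to analytic and probabilistic number theory*, 3rd ed., AMS GSM 163
  (2015), Ch. III.6. [Tenenbaum2015]
* J. D. Lichtman, *A modification of the linear sieve, and the count of twin primes*, Algebra &
  Number Theory 19 (2025), arXiv:2109.02851, Lemma 6.1. [Lichtman2025LinearSieve]
* H. L. Montgomery, R. C. Vaughan, *Multiplicative Number Theory I*, CUP 2007, Cor. 11.20.
  [MontgomeryVaughan2007]
-/

open Finset Filter Real
open scoped Chebyshev Topology

noncomputable section

namespace Literature.NumberTheory.Sieve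

namespace RoughAP

/-! ### The inductive step `n → n + 1` -/

/-- **The inductive step.** If for some `n ≥ 2` and every `ε > 0` eventually (in `x`)
`|Φ(x, y; q, c) − Φ(x, y; q, c')| ≤ ε x/log y` for all `2 ≤ y ≤ x` with `log x ≤ n log y`, `y > q`
and all reduced `c, c'`, then the same holds with `n + 1` in place of `n`: for
`n log y < log x ≤ (n + 1) log y` put `z = x^{1/n}` and apply `abs_card_filter_sub_le_step_of`;
the inequalities between the parameters `y, z, a = ⌈y⌉ − 1, b = ⌈z⌉ − 1` are those of
`abs_card_roughIcc_sub_main_step` (`RoughNumbersBuchstabStep.lean`). [folklore] -/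
theorem abs_card_filter_sub_le_step {q : ℕ} (hq : 0 < q) {n : ℕ} (hn : 2 ≤ n)
    (hP : ∀ ε : ℝ, 0 < ε → ∃ X₀ : ℝ, ∀ X Y : ℝ, X₀ ≤ X → 2 ≤ Y → Y ≤ X →
      Real.log X ≤ n * Real.log Y → (q : ℝ) < Y → ∀ c c' : ℕ, c.Coprime q → c'.Coprime q →
        |(#((roughIcc ⌈Y⌉₊ ⌊X⌋₊).filter (· ≡ c [MOD q])) : ℝ) -
            #((roughIcc ⌈Y⌉₊ ⌊X⌋₊).filter (· ≡ c' [MOD q]))| ≤ ε * X / Real.log Y)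
    {ε : ℝ} (hε : 0 < ε) :
    ∃ X₀ : ℝ, ∀ X Y : ℝ, X₀ ≤ X → 2 ≤ Y → Y ≤ X →
      Real.log X ≤ (n + 1) * Real.log Y → (q : ℝ) < Y → ∀ c c' : ℕ, c.Coprime q → c'.Coprime q →
        |(#((roughIcc ⌈Y⌉₊ ⌊X⌋₊).filter (· ≡ c [MOD q])) : ℝ) -
            #((roughIcc ⌈Y⌉₊ ⌊X⌋₊).filter (· ≡ c' [MOD q]))| ≤ ε * X / Real.log Y := by
  obtain ⟨C₀, hC₀, hE⟩ := Literature.NumberTheory.LFunctions.exists_abs_theta_sub_self_le_div_log_sq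
  set K : ℝ := 1 + ((1 + 2 * C₀) * 3 + 2 * C₀) with hK
  have hK1 : 1 ≤ K := by rw [hK]; nlinarith
  have hK0 : 0 < K := by linarith
  obtain ⟨X₀, hX₀⟩ := hP (ε / K) (by positivity)
  set X₁ : ℝ := max X₀ 1 with hX₁
  have hX₁1 : 1 ≤ X₁ := le_max_right _ _
  have hX₀1 : X₀ ≤ X₁ := le_max_left _ _
  refine ⟨max (X₁ ^ 2) (Real.exp (2 * (n + 1))), ?_⟩
  intro X Y hX hY2 hYX hXY hqY c c' hc hc'
  have hXX₁ : X₁ ^ 2 ≤ X := le_trans (le_max_left _ _) hX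
  have hXX₀ : X₀ ≤ X := hX₀1.trans ((le_self_pow₀ hX₁1 two_ne_zero).trans hXX₁)
  have hy0 : 0 < Y := by linarith
  have hly : 0 < Real.log Y := Real.log_pos (by linarith)
  have hx0 : 0 < X := by linarith
  -- the range `log X ≤ n log Y` is the hypothesis itself
  by_cases hcase : Real.log X ≤ n * Real.log Y
  · refine (hX₀ X Y hXX₀ hY2 hYX hcase hqY c c' hc hc').trans ?_
    rw [mul_div_assoc, mul_div_assoc]
    exact mul_le_mul_of_nonneg_right (div_le_self hε.le hK1) (by positivity)
  push Not at hcase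
  -- numerics about `Y`, `X` (as in `abs_card_roughIcc_sub_main_step`, `k = n`)
  have hk2 : (2 : ℝ) ≤ n := by exact_mod_cast hn
  have hk0 : (0 : ℝ) < n := by linarith
  have hXe : Real.exp (2 * (n + 1)) ≤ X := le_trans (le_max_right _ _) hX
  have hlogX2 : 2 * (n + 1) ≤ Real.log X := by
    rw [Real.le_log_iff_exp_le hx0]; exact hXe
  have hly2 : 2 ≤ Real.log Y := by
    by_contra h
    have : (n + 1) * Real.log Y < (n + 1) * 2 := mul_lt_mul_of_pos_left (lt_of_not_ge h) (by linarith)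
    linarith
  have hy : Real.exp 2 ≤ Y := by rwa [← Real.le_log_iff_exp_le hy0]
  have he1 : (2 : ℝ) ≤ Real.exp 1 := by have := Real.add_one_le_exp (1 : ℝ); linarith
  have he2 : Real.exp 1 ≤ Real.exp 2 - 1 := by
    have h2 : Real.exp 2 = Real.exp 1 * Real.exp 1 := by rw [← Real.exp_add]; norm_num
    nlinarith
  have hLx : 0 < Real.log X := by linarith
  -- `z = X^{1/n}`
  set z : ℝ := Real.exp (Real.log X / n) with hz_def
  have hz0 : 0 < z := Real.exp_pos _
  have hz_log : Real.log z = Real.log X / n := Real.log_exp _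
  have hyz : Y < z := by
    have h : Real.log Y < Real.log X / n := by rw [lt_div_iff₀ hk0]; linarith
    calc Y = Real.exp (Real.log Y) := (Real.exp_log hy0).symm
      _ < z := Real.exp_lt_exp.mpr h
  have hzz : z * z ≤ X := by
    have h : Real.log X / n + Real.log X / n ≤ Real.log X := by
      rw [← two_mul, ← mul_div_assoc, div_le_iff₀ hk0]
      have : Real.log X * 2 ≤ Real.log X * n := mul_le_mul_of_nonneg_left hk2 hLx.le
      linarith
    calc z * z = Real.exp (Real.log X / n + Real.log X / n) := by rw [Real.exp_add]
      _ ≤ Real.exp (Real.log X) := Real.exp_le_exp.mpr h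
      _ = X := Real.exp_log hx0
  have hz1 : 1 ≤ z := by linarith
  have hzx : z ≤ X := le_trans (le_mul_of_one_le_left hz0.le hz1) hzz
  have hz2 : (2 : ℝ) ≤ z := by linarith
  have hxz : Real.log X ≤ n * Real.log z := le_of_eq (by rw [hz_log]; field_simp)
  -- `N = ⌈Y⌉`, `M = ⌈z⌉`, `a = N − 1`, `b = M − 1`
  set N := ⌈Y⌉₊ with hN
  set M := ⌈z⌉₊ with hM
  have hN1 : 0 < N := Nat.ceil_pos.mpr hy0
  have hM1 : 0 < M := Nat.ceil_pos.mpr hz0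
  have hNM : N ≤ M := Nat.ceil_le_ceil hyz.le
  set a : ℝ := ((N - 1 : ℕ) : ℝ) with ha_def
  set b : ℝ := ((M - 1 : ℕ) : ℝ) with hb_def
  have haN : a = (N : ℝ) - 1 := by rw [ha_def, Nat.cast_sub hN1, Nat.cast_one]
  have hbM : b = (M : ℝ) - 1 := by rw [hb_def, Nat.cast_sub hM1, Nat.cast_one]
  have hyN : Y ≤ N := Nat.le_ceil Y
  have hNy : (N : ℝ) < Y + 1 := Nat.ceil_lt_add_one hy0.le
  have hzM : z ≤ M := Nat.le_ceil z
  have hMz : (M : ℝ) < z + 1 := Nat.ceil_lt_add_one hz0.le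
  have hbz : b < z := by rw [hbM]; linarith
  have hab : a ≤ b := by
    rw [haN, hbM]
    have : (N : ℝ) ≤ M := by exact_mod_cast hNM
    linarith
  have hea : Real.exp 1 ≤ a := by linarith
  have ha0 : 0 < a := (Real.exp_pos 1).trans_le hea
  have hasq : Y ≤ a ^ 2 := by
    have h1 : Y - 1 ≤ a := by linarith
    have h2 : (Y - 1) ^ 2 ≤ a ^ 2 := pow_le_pow_left₀ (by linarith) h1 2
    have h3 : Y ≤ (Y - 1) ^ 2 := by nlinarith
    exact h3.trans h2
  have hlya : Real.log Y ≤ 2 * Real.log a := by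
    calc Real.log Y ≤ Real.log (a ^ 2) := Real.log_le_log hy0 hasq
      _ = 2 * Real.log a := by rw [Real.log_pow]; norm_num
  have hb0 : 0 < b := ha0.trans_le hab
  have hlb : Real.log b ≤ 3 * Real.log a := by
    have h1 : (n : ℝ) * Real.log b < Real.log X := by
      calc (n : ℝ) * Real.log b < n * Real.log z :=
            mul_lt_mul_of_pos_left (Real.log_lt_log hb0 hbz) hk0
        _ = Real.log X := by rw [hz_log]; field_simp
    have hla0 : 0 ≤ Real.log a := Real.log_nonneg (by linarith)
    have hkl : 2 * Real.log a ≤ (n : ℝ) * Real.log a := mul_le_mul_of_nonneg_right hk2 hla0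
    have h2 : Real.log X ≤ (n : ℝ) * (3 * Real.log a) := by
      calc Real.log X ≤ (n + 1) * Real.log Y := hXY
        _ ≤ (n + 1) * (2 * Real.log a) := mul_le_mul_of_nonneg_left hlya (by linarith)
        _ ≤ (n : ℝ) * (3 * Real.log a) := by linarith
    exact (lt_of_mul_lt_mul_left (h1.trans_le h2) hk0.le).le
  -- the index set of primes `Y ≤ p < z`
  have hfloor_a : ⌊a⌋₊ = N - 1 := by rw [ha_def, Nat.floor_natCast]
  have hfloor_b : ⌊b⌋₊ = M - 1 := by rw [hb_def, Nat.floor_natCast]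
  have hS : (Finset.Ico N M).filter Nat.Prime = (Finset.Ioc ⌊a⌋₊ ⌊b⌋₊).filter Nat.Prime := by
    rw [hfloor_a, hfloor_b]
    congr 1
    ext p
    simp only [Finset.mem_Ico, Finset.mem_Ioc]
    omega
  have hpS : ∀ p ∈ (Finset.Ioc ⌊a⌋₊ ⌊b⌋₊).filter Nat.Prime,
      p.Prime ∧ Y ≤ (p : ℝ) ∧ (p : ℝ) < z := by
    intro p hp
    rw [Finset.mem_filter, Finset.mem_Ioc, hfloor_a, hfloor_b] at hp
    obtain ⟨⟨h1, h2⟩, hpP⟩ := hp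
    refine ⟨hpP, ?_, ?_⟩
    · have : N ≤ p := by omega
      calc Y ≤ N := hyN
        _ ≤ p := by exact_mod_cast this
    · have : p + 1 ≤ M := by omega
      have : (p : ℝ) + 1 ≤ M := by exact_mod_cast this
      linarith
  -- `X₀ z ≤ X₁ z ≤ X`
  have hX₀z : X₀ * z ≤ X := by
    have h1 : (X₁ * z) ^ 2 ≤ X ^ 2 := by
      calc (X₁ * z) ^ 2 = X₁ ^ 2 * (z * z) := by ring
        _ ≤ X * X := mul_le_mul hXX₁ hzz (mul_nonneg hz0.le hz0.le) hx0.le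
        _ = X ^ 2 := (sq X).symm
    have h2 : X₁ * z ≤ X := (pow_le_pow_iff_left₀ (by positivity) hx0.le two_ne_zero).mp h1
    exact le_trans (mul_le_mul_of_nonneg_right hX₀1 hz0.le) h2
  have h := abs_card_filter_sub_le_step_of hq (div_pos hε hK0).le hC₀ hE hX₀ hN.symm hM.symm hNM
    hS hx0 hXX₀ hX₀z hY2 hqY hz2 hzx hzz hyz hxz hXY hea hab hlb hpS hc hc'
  refine h.trans (le_of_eq ?_)
  rw [← hK]
  field_simp

/-! ### Equidistribution among the reduced classes -/

/-- **Rough numbers are equidistributed among the reduced classes, difference form.** For `q ≥ 1`,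
`n ≥ 2` and `ε > 0` there is `x₀` such that `|Φ(x, y; q, c) − Φ(x, y; q, c')| ≤ ε x/log y` for all
`x ≥ x₀`, `2 ≤ y ≤ x` with `log x ≤ n log y`, `y > q`, and all `c, c'` prime to `q`
(induction on `n`: `abs_card_filter_sub_le_base`, `abs_card_filter_sub_le_step`). [folklore] -/
theorem exists_forall_abs_card_filter_sub_le {q : ℕ} (hq : 0 < q) {n : ℕ} (hn : 2 ≤ n) {ε : ℝ}
    (hε : 0 < ε) :
    ∃ X₀ : ℝ, ∀ X Y : ℝ, X₀ ≤ X → 2 ≤ Y → Y ≤ X → Real.log X ≤ n * Real.log Y → (q : ℝ) < Y →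
      ∀ c c' : ℕ, c.Coprime q → c'.Coprime q →
        |(#((roughIcc ⌈Y⌉₊ ⌊X⌋₊).filter (· ≡ c [MOD q])) : ℝ) -
            #((roughIcc ⌈Y⌉₊ ⌊X⌋₊).filter (· ≡ c' [MOD q]))| ≤ ε * X / Real.log Y := by
  induction n, hn using Nat.le_induction generalizing ε with
  | base =>
    have h := abs_card_filter_sub_le_base hq hε
    push_cast
    exact h
  | succ n hn ih =>
    have h := abs_card_filter_sub_le_step hq hn (fun ε' hε' => ih hε') hε
    push_cast
    exact h

/-- **Rough numbers are equidistributed among the reduced classes.** For `q ≥ 1`, `n ≥ 2` and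
`ε > 0` there is `x₀` such that `|Φ(x, y; q, c) − Φ(x, y)/φ(q)| ≤ ε x/log y` for all `x ≥ x₀`,
`2 ≤ y ≤ x` with `log x ≤ n log y`, `y > q`, and every `c` prime to `q`: the `y`-rough numbers are
prime to `q`, so `φ(q) Φ(x, y; q, c) − Φ(x, y) = ∑_{c'} (Φ(x, y; q, c) − Φ(x, y; q, c'))` over the
reduced classes `c'` (`RoughAP.card_roughIcc_eq_sum_card_filter`).  This is the progression form of
Buchstab's `Φ(x, y) ∼ ω(u) x/log y` (Tenenbaum Ch. III.6). [folklore] -/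
theorem exists_forall_abs_card_filter_sub_div_totient_le {q : ℕ} (hq : 0 < q) {n : ℕ} (hn : 2 ≤ n)
    {ε : ℝ} (hε : 0 < ε) :
    ∃ X₀ : ℝ, ∀ X Y : ℝ, X₀ ≤ X → 2 ≤ Y → Y ≤ X → Real.log X ≤ n * Real.log Y → (q : ℝ) < Y →
      ∀ c : ℕ, c.Coprime q →
        |(#((roughIcc ⌈Y⌉₊ ⌊X⌋₊).filter (· ≡ c [MOD q])) : ℝ) -
            (#(roughIcc ⌈Y⌉₊ ⌊X⌋₊) : ℝ) / q.totient| ≤ ε * X / Real.log Y := by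
  obtain ⟨X₀, hX₀⟩ := exists_forall_abs_card_filter_sub_le hq hn hε
  refine ⟨X₀, fun X Y hX hY2 hYX hXY hqY c hc => ?_⟩
  have hy0 : 0 < Y := by linarith
  set N := ⌈Y⌉₊ with hN
  set XX := ⌊X⌋₊ with hXX
  have hqN : q < N := by
    have : (q : ℝ) < N := hqY.trans_le (Nat.le_ceil Y)
    exact_mod_cast this
  set T := (range q).filter (Nat.Coprime q) with hT
  have hφ : (q.totient : ℝ) = #T := by rw [hT, card_range_filter_coprime]
  have hφ0 : (0 : ℝ) < q.totient := by exact_mod_cast Nat.totient_pos.mpr hq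
  have hsum : (#(roughIcc N XX) : ℝ) = ∑ c' ∈ T, (#((roughIcc N XX).filter (· ≡ c' [MOD q])) : ℝ) := by
    rw [hT, card_roughIcc_eq_sum_card_filter hq hqN XX]; push_cast; rfl
  have hkey : (q.totient : ℝ) * #((roughIcc N XX).filter (· ≡ c [MOD q])) - #(roughIcc N XX) =
      ∑ c' ∈ T, ((#((roughIcc N XX).filter (· ≡ c [MOD q])) : ℝ) -
        #((roughIcc N XX).filter (· ≡ c' [MOD q]))) := by
    rw [Finset.sum_sub_distrib, Finset.sum_const, nsmul_eq_mul, hsum, hφ]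
  have hbound : |(q.totient : ℝ) * #((roughIcc N XX).filter (· ≡ c [MOD q])) - #(roughIcc N XX)| ≤
      (q.totient : ℝ) * (ε * X / Real.log Y) := by
    rw [hkey, hφ]
    refine (Finset.abs_sum_le_sum_abs _ _).trans ?_
    calc _ ≤ ∑ c' ∈ T, ε * X / Real.log Y := Finset.sum_le_sum fun c' hc' => by
          have hc'q : c'.Coprime q := (Finset.mem_filter.mp hc').2.symm
          exact hX₀ X Y hX hY2 hYX hXY hqY c c' hc hc'q
      _ = #T * (ε * X / Real.log Y) := by rw [Finset.sum_const, nsmul_eq_mul]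
  have e : (#((roughIcc N XX).filter (· ≡ c [MOD q])) : ℝ) - (#(roughIcc N XX) : ℝ) / q.totient =
      ((q.totient : ℝ) * #((roughIcc N XX).filter (· ≡ c [MOD q])) - #(roughIcc N XX)) /
        q.totient := by
    field_simp
  rw [e, abs_div, abs_of_pos hφ0, div_le_iff₀ hφ0]
  calc _ ≤ (q.totient : ℝ) * (ε * X / Real.log Y) := hbound
    _ = ε * X / Real.log Y * q.totient := by ring

/-! ### Buchstab's asymptotic in a reduced class -/

/-- **Buchstab's asymptotic for the rough numbers of a reduced residue class.** For `q ≥ 1`, real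
`U` and `ε > 0` there is `x₀` such that
`|Φ(x, y; q, c) − ω(log x/log y) x/(φ(q) log y)| ≤ ε x/log y` for all `x ≥ x₀`, `2 ≤ y`, `q < y`,
`y² ≤ x ≤ y^U` and every `c` prime to `q`, where `ω` is Buchstab's function (`buchstabOmega`): the
PROVED integer law `|Φ(x, y) − ω(u) x/log y| ≤ C x/log² y`
(`exists_abs_card_roughIcc_sub_buchstab_le`, Lichtman's Lemma 6.1) divided by `φ(q)`, and
`exists_forall_abs_card_filter_sub_div_totient_le` with `n = max 2 ⌈U⌉`.  Qualitative form of
`Φ(x, y; q, c) ∼ ω(u) x/(φ(q) log y)` (Tenenbaum Ch. III.6 for `q = 1`). [folklore] -/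
theorem exists_forall_abs_card_filter_sub_buchstab_le {q : ℕ} (hq : 0 < q) (U : ℝ) {ε : ℝ}
    (hε : 0 < ε) :
    ∃ X₀ : ℝ, ∀ X Y : ℝ, X₀ ≤ X → 2 ≤ Y → (q : ℝ) < Y → Y ^ 2 ≤ X → X ≤ Y ^ U →
      ∀ c : ℕ, c.Coprime q →
        |(#((roughIcc ⌈Y⌉₊ ⌊X⌋₊).filter (· ≡ c [MOD q])) : ℝ) -
            buchstabOmega (Real.log X / Real.log Y) * X / (q.totient * Real.log Y)| ≤
          ε * X / Real.log Y := by
  obtain ⟨C, hC, hint⟩ := exists_abs_card_roughIcc_sub_buchstab_le U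
  set n : ℕ := max 2 ⌈U⌉₊ with hn
  have hn2 : 2 ≤ n := le_max_left _ _
  obtain ⟨X₀, hX₀⟩ :=
    exists_forall_abs_card_filter_sub_div_totient_le hq hn2 (ε := ε / 2) (by positivity)
  set U' : ℝ := max U 1 with hU'
  have hU'0 : 0 < U' := lt_of_lt_of_le one_pos (le_max_right _ _)
  refine ⟨max X₀ (Real.exp (U' * (2 * C / ε + 1))), ?_⟩
  intro X Y hX hY2 hqY hYX hXU c hc
  have hy0 : 0 < Y := by linarith
  have hly : 0 < Real.log Y := Real.log_pos (by linarith)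
  have hYX' : Y ≤ X := le_trans (by nlinarith) hYX
  have hx0 : 0 < X := by linarith
  have hφ0 : (0 : ℝ) < q.totient := by exact_mod_cast Nat.totient_pos.mpr hq
  have hφ1 : (1 : ℝ) ≤ q.totient := by exact_mod_cast Nat.totient_pos.mpr hq
  -- `log X ≤ U log Y ≤ n log Y` and `log Y ≥ 2C/ε + 1`
  have hlogXU : Real.log X ≤ U * Real.log Y := by
    have h := Real.log_le_log hx0 hXU
    rwa [Real.log_rpow hy0] at h
  have hUn : U ≤ (n : ℝ) := by
    calc U ≤ ⌈U⌉₊ := Nat.le_ceil U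
      _ ≤ (n : ℝ) := by exact_mod_cast le_max_right 2 ⌈U⌉₊
  have hlogXn : Real.log X ≤ n * Real.log Y :=
    hlogXU.trans (mul_le_mul_of_nonneg_right hUn hly.le)
  have hlogXU' : Real.log X ≤ U' * Real.log Y :=
    hlogXU.trans (mul_le_mul_of_nonneg_right (le_max_left _ _) hly.le)
  have hlogX : U' * (2 * C / ε + 1) ≤ Real.log X := by
    rw [Real.le_log_iff_exp_le hx0]; exact le_trans (le_max_right _ _) hX
  have hlyC : 2 * C / ε + 1 ≤ Real.log Y :=
    le_of_mul_le_mul_left (hlogX.trans hlogXU') hU'0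
  -- the two approximations
  have h1 := hX₀ X Y (le_trans (le_max_left _ _) hX) hY2 hYX' hlogXn hqY c hc
  have h2 := hint X Y hY2 hYX hXU
  have h2' : |(#(roughIcc ⌈Y⌉₊ ⌊X⌋₊) : ℝ) / q.totient -
      buchstabOmega (Real.log X / Real.log Y) * X / (q.totient * Real.log Y)| ≤
      C * X / Real.log Y ^ 2 := by
    have e : (#(roughIcc ⌈Y⌉₊ ⌊X⌋₊) : ℝ) / q.totient -
        buchstabOmega (Real.log X / Real.log Y) * X / (q.totient * Real.log Y) =
        ((#(roughIcc ⌈Y⌉₊ ⌊X⌋₊) : ℝ) - buchstabOmega (Real.log X / Real.log Y) * X / Real.log Y) /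
          q.totient := by
      field_simp
    rw [e, abs_div, abs_of_pos hφ0]
    exact (div_le_self (abs_nonneg _) hφ1).trans h2
  have h3 : C * X / Real.log Y ^ 2 ≤ ε / 2 * X / Real.log Y := by
    have hCε : C ≤ ε / 2 * Real.log Y := by
      have : 2 * C / ε ≤ Real.log Y := by linarith
      rw [div_le_iff₀ hε] at this
      linarith
    calc C * X / Real.log Y ^ 2 = C * (X / Real.log Y ^ 2) := by ring
      _ ≤ ε / 2 * Real.log Y * (X / Real.log Y ^ 2) :=
          mul_le_mul_of_nonneg_right hCε (by positivity)
      _ = ε / 2 * X / Real.log Y := by field_simp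
  calc _ ≤ |(#((roughIcc ⌈Y⌉₊ ⌊X⌋₊).filter (· ≡ c [MOD q])) : ℝ) -
          (#(roughIcc ⌈Y⌉₊ ⌊X⌋₊) : ℝ) / q.totient| +
        |(#(roughIcc ⌈Y⌉₊ ⌊X⌋₊) : ℝ) / q.totient -
          buchstabOmega (Real.log X / Real.log Y) * X / (q.totient * Real.log Y)| :=
        abs_sub_le _ _ _
    _ ≤ ε / 2 * X / Real.log Y + ε / 2 * X / Real.log Y := add_le_add h1 (h2'.trans h3)
    _ = ε * X / Real.log Y := by ring

end RoughAP

end Literature.NumberTheory.Sieve
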